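import Literature.NumberTheory.EllipticCurves.IwasawaAlgebra
import HarnessLib

/-!
# W2plusPrice47 (crux-triage r1 seat 2/2, GEN 47 ADDENDUM-2) — the EXACT PRICE of the v21 stub `stub_colemanHalf_posDisc_two` (W2⁺)
# of crux `OrdKatoHalfAtTwoIso` (stmt-BirchSwinnertonDyer-19573), line `steinberg-fibre-at-two` — answer to LEAD g9's
# «per-stub vet welcome, esp. the W2⁺ pricing note» (HOME INBOX 14:19Z).

KERNEL PART (this file, generic algebra, `exists_package_of_muFreeValue`): the ∃-package of W2⁺ —
`∃ y u M L′ r, M ∉ (2) ∧ ‖r‖ = 1 ∧ ι L′ = C r·L₂ ∧ col (loc y) = u·M·L′` — FOLLOWS from the two-line datum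
«ONE global class `y₀` whose value `col (loc y₀)` is not in `(2)`» + «an integral unit-normalised lift `L′` of `L₂(f, α)` exists» (INT2-AUTO),
by `y := L′ • y₀`, `u := 1`, `M := col (loc y₀)`: the `u / M / L′ / r` dressing and the freedom in `y` carry NO content beyond
«the ideal `A = col(loc 𝐇¹_Γ) ⊆ Λ` is not inside `(2)`», i.e. `μ(Λ/A) = 0`.

PAPER PART (classical, recorded in TRIAGE-r1-2 ADDENDUM-2; not kernel): every admissible `col` (Λ-linear `J.H → Λ`, `ker col ≤ range(J′→J)`)
has `ker col = range(J′ → J)` exactly (rank count + `Λ` torsion-free) and is a `Λ`-multiple of the primitive functional `col₀` on the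
rank-one torsion-free quotient `N = 𝐇¹_{loc,Γ}(T₂W)/𝐇¹_{loc,Γ}(F⁺T₂W)` (`Hom_Λ(N, Λ)` is reflexive of rank 1, hence free); with
`A₀ = col₀(loc 𝐇¹_Γ)` and `μ(Λ/A₀) = μ(N / loc 𝐇¹_Γ)` (=: μ of the COARSE quotient; `coker col₀` is pseudo-null):
  **W2⁺ ⟺ μ(coarse quotient) ≤ μ(L₂(f, α))** (⇐: `y := λ•y₀` with `col₀(loc y₀)` of minimal 2-content; ⇒: 2-contents add in the UFD `Λ`).
Print (Kato's genuine class `z_{γ₁}`, `γ₁` the real cycle; on `0 < Δ` the period lattice is rectangular, `Ω_E = 2·Ω₁` — lead F-27a) gives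
`μ(coarse) ≤ μ(L₂) + 1`: the gap is EXACTLY ONE factor `2` (the half class). By Poitou–Tate with weak Leopoldt (Kato 12.4) the coarse quotient
embeds in `X(E/ℚ_∞)` with cokernel the strict/fine dual, so `μ(X) = μ(coarse) + μ(fine)`; hence Greenberg Conj. 1.11 at `2` (`μ(X) = 0`)
⇒ W2⁺ (the lead's reading note, confirmed), Q⁺ = Conj. A at `(W, 2)` = «`μ(fine) = 0`», and W2⁺ ∧ Q⁺ ⇒ `μ(X) ≤ μ(L₂)` = the crux's μ-part on
the cell: an honest PARTITION (coarse / fine), neither half restating the crux — no costume; tier memo/OPEN as labelled. BSD is not proved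
by any of this; nothing here closes a stub.
-/

set_option autoImplicit false
set_option linter.dupNamespace false

namespace Summit.BirchSwinnertonDyer.BirchSwinnertonDyer.Cruxes.OrdKatoHalfAtTwoIso.W2plusPrice47

/-- **The W2⁺ ∃-package from ONE class with a value outside `P` plus an integral lift.** Generic algebra: `Λ` any commutative
ring, `loc : IH →ₗ JH`, `col : JH →ₗ Λ`, `P` any ideal (for W2⁺: `Λ = ℤ₂⟦T⟧`, `P = (2)`), `INT L′` any predicate (for W2⁺:
`∃ r, ‖r‖ = 1 ∧ ι L′ = C r · L₂(f, α)`). Witness: `y := L′ • y₀`, `u := 1`, `M := col (loc y₀)`. [folklore] -/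
theorem exists_package_of_muFreeValue {Λ : Type*} [CommRing Λ] {IH JH : Type*} [AddCommGroup IH] [Module Λ IH]
    [AddCommGroup JH] [Module Λ JH] (loc : IH →ₗ[Λ] JH) (col : JH →ₗ[Λ] Λ) (P : Ideal Λ) (INT : Λ → Prop)
    (y₀ : IH) (h₀ : col (loc y₀) ∉ P) (L' : Λ) (hL' : INT L') :
    ∃ (y : IH) (u : Λˣ) (M L'' : Λ), M ∉ P ∧ INT L'' ∧ col (loc y) = (u : Λ) * M * L'' :=
  ⟨L' • y₀, 1, col (loc y₀), L', h₀, hL', by simp [map_smul, smul_eq_mul, mul_comm]⟩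

/-- Conversely the package gives back a class whose value has the SAME `P`-membership as `M·L″` up to a unit — in particular for a PRIME
`P` not containing `L″` (for W2⁺: `μ(L₂) = 0`), a class with value outside `P`. [folklore] -/
theorem muFreeValue_of_package {Λ : Type*} [CommRing Λ] {IH JH : Type*} [AddCommGroup IH] [Module Λ IH]
    [AddCommGroup JH] [Module Λ JH] (loc : IH →ₗ[Λ] JH) (col : JH →ₗ[Λ] Λ) (P : Ideal Λ) (hP : P.IsPrime)
    (y : IH) (u : Λˣ) (M L'' : Λ) (hM : M ∉ P) (hL : L'' ∉ P) (hcol : col (loc y) = (u : Λ) * M * L'') :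
    col (loc y) ∉ P := by
  rw [hcol]
  intro h
  rcases hP.mem_or_mem h with h1 | h2
  · rcases hP.mem_or_mem h1 with hu | hm
    · exact hP.ne_top (Ideal.eq_top_of_isUnit_mem P hu u.isUnit)
    · exact hM hm
  · exact hL h2

end Summit.BirchSwinnertonDyer.BirchSwinnertonDyer.Cruxes.OrdKatoHalfAtTwoIso.W2plusPrice47
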